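import Literature.AlgebraicGeometry.Motives.AbelianVarietyConjugate
import Literature.AlgebraicGeometry.Motives.AbelianVarietyProduct
import HarnessLib

/-!
# Base change / Galois conjugation of a biproduct of abelian varieties: `σ(A ⊞ B) ≅ σA ⊞ σB`

Layer `Literature/AlgebraicGeometry/Motives`, namespace `Literature.AlgebraicGeometry.Motives.AbelianVariety`.
KERNEL ONLY: theorems; no definition, no named fact, no instance, no `sorry`.

Base change along a field homomorphism `σ : k → L` (`baseChangeAlong σ`, Milne 2005 §11 «extension of the base
field»; special case: conjugation `A ↦ A^σ` by `σ ∈ Aut(L)`, `conjugate σ`) is an ADDITIVE functor on the tree's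
category of abelian varieties (`Hom.baseChangeAlong_add/_comp/_id`), hence commutes with the biproduct: there is a
canonical isomorphism `σ(A ⊞ B) ≅ σA ⊞ σB` intertwining the base changes of the four structure maps `pr_A`, `pr_B`,
`in_A`, `in_B` with those of `σA ⊞ σB` (`exists_iso_baseChangeAlong_biprod`, `exists_iso_conjugate_biprod`).  The
comparison is written on the cell's CHOSEN biproduct (global `HasBinaryBiproducts (AbelianVariety L)` of
`Motives/AbelianVarietyProduct`) as `biprod.lift (σ pr_A) (σ pr_B)` with inverse `biprod.desc (σ in_A) (σ in_B)`, so
no instance other than the category's own is involved (Mathlib's generic `Functor.mapBiprod` lands in the biproduct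
object manufactured from the functor, which is not this one).  On points: `(pr_A x)^σ = (σ pr_A)(x^σ)` (★
`conjPoints_map`).

Use (cell `hodgecm-mathlib`, road #60 `SiegelS1`, A-p05 MUMFORD-LINE-SPEC §2 T3 «main theorem of CM for CM ALGEBRAS
from the field case by `⊞`», leaf R60-24): the conjugate of a product of CM abelian varieties is the product of the
conjugates, compatibly with projections, inclusions and points.

## References
* [Milne2005ShimuraVarieties] J. S. Milne, *Introduction to Shimura varieties* (2005), §11 p. 108 («extension of the
  base field», the functor `V ↦ σV`).
* [MumfordAV1970] D. Mumford, *Abelian Varieties* (1970), §19 (`Hom(A × B, C) = Hom(A, C) × Hom(B, C)`).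
* [Shimura1998] G. Shimura, *Abelian Varieties with Complex Multiplication and Modular Functions* (1998), §18.6.
-/

universe u

open CategoryTheory CategoryTheory.Limits AlgebraicGeometry

noncomputable section

namespace Literature.AlgebraicGeometry.Motives

namespace AbelianVariety

variable {k : Type u} [Field k] {L : Type u} [Field L]

/-! ### Additivity consequences of `Hom.baseChangeAlong_add` -/

section Along

variable (σ : k →+* L) {A B C : AbelianVariety k}

/-- `σ 0 = 0`. [cite: Milne2005ShimuraVarieties, §11 p. 108] -/
theorem Hom.baseChangeAlong_zero : Hom.baseChangeAlong σ (0 : A ⟶ B) = 0 := by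
  have h := Hom.baseChangeAlong_add σ (0 : A ⟶ B) 0
  rw [add_zero] at h
  exact left_eq_add.1 h

/-- `σ(-f) = -σf`. [cite: Milne2005ShimuraVarieties, §11 p. 108] -/
theorem Hom.baseChangeAlong_neg (f : A ⟶ B) : Hom.baseChangeAlong σ (-f) = -Hom.baseChangeAlong σ f := by
  have h := Hom.baseChangeAlong_add σ (-f) f
  rw [neg_add_cancel, Hom.baseChangeAlong_zero] at h
  exact (neg_eq_of_add_eq_zero_left h.symm).symm

/-- `σ(f - g) = σf - σg`. [cite: Milne2005ShimuraVarieties, §11 p. 108] -/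
theorem Hom.baseChangeAlong_sub (f g : A ⟶ B) :
    Hom.baseChangeAlong σ (f - g) = Hom.baseChangeAlong σ f - Hom.baseChangeAlong σ g := by
  rw [sub_eq_add_neg, Hom.baseChangeAlong_add, Hom.baseChangeAlong_neg, ← sub_eq_add_neg]

/-! ### `σ(A ⊞ B) ≅ σA ⊞ σB` -/

/-- **Base change commutes with the biproduct**: an isomorphism `e : σ(A ⊞ B) ≅ σA ⊞ σB` with
`e.hom ≫ pr = σ pr`, `in ≫ e.inv = σ in` for both factors (and the two transposed identities).  Construction:
`e.hom = ⟨σ pr_A, σ pr_B⟩`, `e.inv = [σ in_A, σ in_B]`; the identities `in_A ≫ pr_A = 𝟙`, `in_A ≫ pr_B = 0`, …,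
`pr_A ≫ in_A + pr_B ≫ in_B = 𝟙` are transported by the additive `σ`.
[cite: Milne2005ShimuraVarieties, §11 p. 108] [cite: MumfordAV1970, §19 (Hom(A × B, C))] -/
theorem exists_iso_baseChangeAlong_biprod (A B : AbelianVariety k) :
    ∃ e : (A ⊞ B).baseChangeAlong σ ≅ A.baseChangeAlong σ ⊞ B.baseChangeAlong σ,
      e.hom ≫ biprod.fst = Hom.baseChangeAlong σ (biprod.fst : A ⊞ B ⟶ A) ∧
      e.hom ≫ biprod.snd = Hom.baseChangeAlong σ (biprod.snd : A ⊞ B ⟶ B) ∧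
      biprod.inl ≫ e.inv = Hom.baseChangeAlong σ (biprod.inl : A ⟶ A ⊞ B) ∧
      biprod.inr ≫ e.inv = Hom.baseChangeAlong σ (biprod.inr : B ⟶ A ⊞ B) ∧
      Hom.baseChangeAlong σ (biprod.inl : A ⟶ A ⊞ B) ≫ e.hom = biprod.inl ∧
      Hom.baseChangeAlong σ (biprod.inr : B ⟶ A ⊞ B) ≫ e.hom = biprod.inr := by
  -- the two candidate maps
  set φ : (A ⊞ B).baseChangeAlong σ ⟶ A.baseChangeAlong σ ⊞ B.baseChangeAlong σ :=
    biprod.lift (Hom.baseChangeAlong σ (biprod.fst : A ⊞ B ⟶ A)) (Hom.baseChangeAlong σ (biprod.snd : A ⊞ B ⟶ B))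
    with hφ
  set ψ : A.baseChangeAlong σ ⊞ B.baseChangeAlong σ ⟶ (A ⊞ B).baseChangeAlong σ :=
    biprod.desc (Hom.baseChangeAlong σ (biprod.inl : A ⟶ A ⊞ B)) (Hom.baseChangeAlong σ (biprod.inr : B ⟶ A ⊞ B))
    with hψ
  -- `σ in ≫ φ = in`
  have hinl : Hom.baseChangeAlong σ (biprod.inl : A ⟶ A ⊞ B) ≫ φ = biprod.inl := by
    apply biprod.hom_ext
    · rw [Category.assoc, hφ, biprod.lift_fst, ← Hom.baseChangeAlong_comp, biprod.inl_fst,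
        Hom.baseChangeAlong_id, biprod.inl_fst]
    · rw [Category.assoc, hφ, biprod.lift_snd, ← Hom.baseChangeAlong_comp, biprod.inl_snd,
        Hom.baseChangeAlong_zero, biprod.inl_snd]
  have hinr : Hom.baseChangeAlong σ (biprod.inr : B ⟶ A ⊞ B) ≫ φ = biprod.inr := by
    apply biprod.hom_ext
    · rw [Category.assoc, hφ, biprod.lift_fst, ← Hom.baseChangeAlong_comp, biprod.inr_fst,
        Hom.baseChangeAlong_zero, biprod.inr_fst]
    · rw [Category.assoc, hφ, biprod.lift_snd, ← Hom.baseChangeAlong_comp, biprod.inr_snd,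
        Hom.baseChangeAlong_id, biprod.inr_snd]
  -- `ψ ≫ φ = 𝟙`
  have h1 : ψ ≫ φ = 𝟙 _ := by
    apply biprod.hom_ext'
    · rw [hψ, biprod.inl_desc_assoc, Category.comp_id]
      exact hinl
    · rw [hψ, biprod.inr_desc_assoc, Category.comp_id]
      exact hinr
  -- `φ ≫ ψ = 𝟙`: `σ(pr_A ≫ in_A + pr_B ≫ in_B) = σ 𝟙`
  have h2 : φ ≫ ψ = 𝟙 _ := by
    rw [hφ, hψ, biprod.lift_desc, ← Hom.baseChangeAlong_comp, ← Hom.baseChangeAlong_comp,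
      ← Hom.baseChangeAlong_add, biprod.total, Hom.baseChangeAlong_id]
  refine ⟨⟨φ, ψ, h2, h1⟩, ?_, ?_, ?_, ?_, hinl, hinr⟩
  · exact biprod.lift_fst _ _
  · exact biprod.lift_snd _ _
  · exact biprod.inl_desc _ _
  · exact biprod.inr_desc _ _

end Along

/-! ### The conjugate of a biproduct, and points -/

section Conjugate

variable (σ : L ≃+* L) {A B : AbelianVariety L}

/-- `(0)^σ = 0`. [cite: Milne2005ShimuraVarieties, §11 p. 108] -/
theorem Hom.conjugate_zero : Hom.conjugate σ (0 : A ⟶ B) = 0 := Hom.baseChangeAlong_zero σ.toRingHom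

/-- `(-f)^σ = -f^σ`. [cite: Milne2005ShimuraVarieties, §11 p. 108] -/
theorem Hom.conjugate_neg (f : A ⟶ B) : Hom.conjugate σ (-f) = -Hom.conjugate σ f :=
  Hom.baseChangeAlong_neg σ.toRingHom f

variable (A B) in
/-- **`(A ⊞ B)^σ ≅ A^σ ⊞ B^σ`** compatibly with the conjugates of the projections and inclusions (the additive
functor `A ↦ A^σ` preserves biproducts). [cite: Milne2005ShimuraVarieties, §11 p. 108] [cite: Shimura1998, §18.6 Thm. 18.6 (2) p. 127] -/
theorem exists_iso_conjugate_biprod :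
    ∃ e : (A ⊞ B).conjugate σ ≅ A.conjugate σ ⊞ B.conjugate σ,
      e.hom ≫ biprod.fst = Hom.conjugate σ (biprod.fst : A ⊞ B ⟶ A) ∧
      e.hom ≫ biprod.snd = Hom.conjugate σ (biprod.snd : A ⊞ B ⟶ B) ∧
      biprod.inl ≫ e.inv = Hom.conjugate σ (biprod.inl : A ⟶ A ⊞ B) ∧
      biprod.inr ≫ e.inv = Hom.conjugate σ (biprod.inr : B ⟶ A ⊞ B) ∧
      Hom.conjugate σ (biprod.inl : A ⟶ A ⊞ B) ≫ e.hom = biprod.inl ∧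
      Hom.conjugate σ (biprod.inr : B ⟶ A ⊞ B) ≫ e.hom = biprod.inr :=
  exists_iso_baseChangeAlong_biprod σ.toRingHom A B

/-- **Points: `(pr_A x)^σ = pr_A^σ (x^σ)`** for a point `x` of `A ⊞ B`, where `pr_A^σ = (pr_A)^σ` is read through any
comparison `e` as `e.hom ≫ pr`.  [cite: Shimura1998, §18.6 Thm. 18.6 (2) p. 127] [cite: Milne2005ShimuraVarieties, §11 p. 108] -/
theorem conjPoints_map_biprod_fst (e : (A ⊞ B).conjugate σ ≅ A.conjugate σ ⊞ B.conjugate σ)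
    (he : e.hom ≫ biprod.fst = Hom.conjugate σ (biprod.fst : A ⊞ B ⟶ A)) (P : (A ⊞ B).Points L) :
    A.conjPoints σ (AlgPoints.map (biprod.fst : A ⊞ B ⟶ A).hom.hom.hom P) =
      AlgPoints.map (e.hom ≫ biprod.fst).hom.hom.hom ((A ⊞ B).conjPoints σ P) := by
  rw [he]
  exact conjPoints_map σ biprod.fst P

/-- The same for the second projection. [cite: Shimura1998, §18.6 Thm. 18.6 (2) p. 127] -/
theorem conjPoints_map_biprod_snd (e : (A ⊞ B).conjugate σ ≅ A.conjugate σ ⊞ B.conjugate σ)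
    (he : e.hom ≫ biprod.snd = Hom.conjugate σ (biprod.snd : A ⊞ B ⟶ B)) (P : (A ⊞ B).Points L) :
    B.conjPoints σ (AlgPoints.map (biprod.snd : A ⊞ B ⟶ B).hom.hom.hom P) =
      AlgPoints.map (e.hom ≫ biprod.snd).hom.hom.hom ((A ⊞ B).conjPoints σ P) := by
  rw [he]
  exact conjPoints_map σ biprod.snd P

/-- **`(f ⊞ g)^σ` is `f^σ ⊞ g^σ`** through the comparison: `e.hom ≫ biprod.map f^σ g^σ = (biprod.map f g)^σ ≫ e'.hom`
for comparisons `e` (of `A ⊞ B`) and `e'` (of `A' ⊞ B'`) satisfying the projection identities.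
[cite: Milne2005ShimuraVarieties, §11 p. 108] -/
theorem conjugate_biprod_map {A' B' : AbelianVariety L} (f : A ⟶ A') (g : B ⟶ B')
    (e : (A ⊞ B).conjugate σ ≅ A.conjugate σ ⊞ B.conjugate σ)
    (hefst : e.hom ≫ biprod.fst = Hom.conjugate σ (biprod.fst : A ⊞ B ⟶ A))
    (hesnd : e.hom ≫ biprod.snd = Hom.conjugate σ (biprod.snd : A ⊞ B ⟶ B))
    (e' : (A' ⊞ B').conjugate σ ≅ A'.conjugate σ ⊞ B'.conjugate σ)
    (he'fst : e'.hom ≫ biprod.fst = Hom.conjugate σ (biprod.fst : A' ⊞ B' ⟶ A'))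
    (he'snd : e'.hom ≫ biprod.snd = Hom.conjugate σ (biprod.snd : A' ⊞ B' ⟶ B')) :
    e.hom ≫ biprod.map (Hom.conjugate σ f) (Hom.conjugate σ g) = Hom.conjugate σ (biprod.map f g) ≫ e'.hom := by
  apply biprod.hom_ext
  · rw [Category.assoc, biprod.map_fst, ← Category.assoc, hefst, Category.assoc, he'fst,
      ← Hom.conjugate_comp, ← Hom.conjugate_comp, biprod.map_fst]
  · rw [Category.assoc, biprod.map_snd, ← Category.assoc, hesnd, Category.assoc, he'snd,
      ← Hom.conjugate_comp, ← Hom.conjugate_comp, biprod.map_snd]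

end Conjugate

end AbelianVariety

end Literature.AlgebraicGeometry.Motives

end
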